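import Literature.Probability.Distributions.GaussianWickTheorem
import Mathlib.Algebra.MvPolynomial.CommRing
import HarnessLib

/-!
# `SourcedPressureIncrement` (stmt-QuantumFields-22517), line `birth`: products of WICK SQUARES of a centred Gaussian
# process (engine file 1/3 toward the second `h`-cumulant of the Gaussian sourced increment, `stub_gauss` / cold-box item
# stmt-QuantumFields-23807)

Helper toward the deciding crux item stmt-QuantumFields-22517
(`Summit.QuantumFields.YangMills.Theses.SourcedPressureJensen.SourcedPressureIncrement`, route `SourcedPressureJensen`; BC3 birth
skeleton `bc/SourcedPressureIncrement_birth.lean`, stubs `stub_gauss` + `stub_laplace`; rev-5 split: cold box stmt-QuantumFields-23807 +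
decoupling stmt-QuantumFields-23808).  The source of `gaussIncrement` is `H_B = Σ_{x∈B} A_x A_{x+ne₀}` with `A_x = (λ/2) Σ_a W_{(p₁₂x, a)}`,
`W_t = X_t² − E X_t²` the WICK SQUARE of the plaquette variable `X_t = Y_p^a`; its first cumulant is exact
(`GaussFirstCumulant`), and its second cumulant `Var_γ(H_B)` is a sum of covariances of products of Wick squares.  This file is
the abstract Gaussian calculus of such products, for ANY centred Gaussian process `X : T → Ω → ℝ` (Mathlib `IsGaussianProcess`),
on top of the tree's Wick engine `Literature.Probability.Distributions.GaussianWick` (`integral_wick2_mul_prod`,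
`integral_wick4_mul_prod`, `integral_prod_four`):

* `integrable_mvPolynomial_eval` — polynomials in finitely many coordinates are integrable;
* `integral_wickSq_mul_wickSq` — `E[W_cW_e] = 2S_ce²` (`S_st = E[X_sX_t]`);
* `integral_wick2_mul_legs2/4`, `integral_wick4sq_mul_legs2/4`, `integral_wick4sq_eq_zero` — the Wick pair `X_aX_b − S_ab` and
  the Wick quartet `:X_a²X_b²:` contracted into the legs `c, c` / `c, c, e, e`;
* **`integral_wickSq_four`** — `E[W_aW_bW_cW_e] = 4S_ab²S_ce² + 4S_ac²S_be² + 4S_ae²S_bc² + 16S_acS_aeS_bcS_be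
  + 16S_abS_ce(S_acS_be + S_aeS_bc)` (the sixty pairings of eight legs with no self-line: three double-edge covers and three
  four-cycles), via `W_aW_b = :X_a²X_b²: + 4S_ab(X_aX_b − S_ab) + 2S_ab²`.

Files 2/3 (`…GaussWickCovariance`) and 3/3 (`…GaussSecondCumulant`) specialise to the curvature Gaussian field and sum the decay.
RECORD-label rung support (all-`G` leaf `WeakCouplingRates.XiPow`); the Yang–Mills mass gap is NOT proved by anything here.
Sources: S. Janson, *Gaussian Hilbert Spaces* (1997) Thm 1.28; Glimm–Jaffe, *Quantum Physics* (1987) Cor. 8.3.2. [folklore]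
-/

noncomputable section

open MeasureTheory ProbabilityTheory
open Literature.Probability.Distributions

namespace Summit.QuantumFields.YangMills.Cruxes.SourcedPressureIncrement.Birth

/-! ### §1 Products of Wick squares of a centred Gaussian process -/

section WickSquares

variable {T Ω : Type*} {mΩ : MeasurableSpace Ω} {P : Measure Ω} {X : T → Ω → ℝ}

/-- Polynomial expressions in finitely many coordinates of a Gaussian process are integrable (every monomial is a
finite product of coordinates, `GaussianWick.integrable_prod`). [cite: Janson1997, Ch. 1 §3, sentence before Thm 1.28] -/
theorem integrable_mvPolynomial_eval (hX : IsGaussianProcess X P) {σ : Type*} (t : σ → T)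
    (p : MvPolynomial σ ℝ) :
    Integrable (fun ω => MvPolynomial.eval (fun i => X (t i) ω) p) P := by
  classical
  induction p using MvPolynomial.induction_on' with
  | monomial s a =>
    have h := GaussianWick.integrable_prod hX (s.support.sigma fun i => Finset.range (s i)) (fun q => t q.1)
    have e : ∀ ω, MvPolynomial.eval (fun i => X (t i) ω) (MvPolynomial.monomial s a) =
        a * ∏ q ∈ s.support.sigma (fun i => Finset.range (s i)), X (t q.1) ω := by
      intro ω
      rw [MvPolynomial.eval_monomial, Finsupp.prod, Finset.prod_sigma]
      simp only [Finset.prod_const, Finset.card_range]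
    simp_rw [e]
    exact h.const_mul a
  | add p q hp hq =>
    simp_rw [map_add]
    exact hp.add hq

/-- `E[X_c² X_e²] = S_cc S_ee + 2 S_ce²` (`S_st = E[X_sX_t]`; the three pairings). [cite: Janson1997, Thm 1.28] -/
theorem integral_sq_mul_sq_gaussianProcess (hX : IsGaussianProcess X P) (h0 : ∀ t, ∫ ω, X t ω ∂P = 0) (c e : T) :
    ∫ ω, X c ω * X c ω * X e ω * X e ω ∂P =
      (∫ ω, X c ω * X c ω ∂P) * (∫ ω, X e ω * X e ω ∂P) + 2 * (∫ ω, X c ω * X e ω ∂P) ^ 2 := by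
  have h := GaussianWick.integral_prod_four hX h0 ![c, c, e, e]
  simp only [Matrix.cons_val_zero, Matrix.cons_val_one, Matrix.cons_val] at h
  rw [h]
  ring

/-- **Two Wick squares**: `E[(X_c² − S_cc)(X_e² − S_ee)] = 2 S_ce²`. [cite: Janson1997, Thm 1.28] -/
theorem integral_wickSq_mul_wickSq (hX : IsGaussianProcess X P) (h0 : ∀ t, ∫ ω, X t ω ∂P = 0) (c e : T) :
    ∫ ω, (X c ω * X c ω - ∫ ω', X c ω' * X c ω' ∂P) * (X e ω * X e ω - ∫ ω', X e ω' * X e ω' ∂P) ∂P =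
      2 * (∫ ω, X c ω * X e ω ∂P) ^ 2 := by
  have := hX.isProbabilityMeasure
  have i4 : Integrable (fun ω => X c ω * X c ω * X e ω * X e ω) P :=
    (integrable_mvPolynomial_eval hX ![c, e]
      (MvPolynomial.X 0 * MvPolynomial.X 0 * MvPolynomial.X 1 * MvPolynomial.X 1)).congr
      (ae_of_all _ fun ω => by simp)
  have icc : Integrable (fun ω => X c ω * X c ω) P :=
    (integrable_mvPolynomial_eval hX ![c, e] (MvPolynomial.X 0 * MvPolynomial.X 0)).congr
      (ae_of_all _ fun ω => by simp)
  have iee : Integrable (fun ω => X e ω * X e ω) P :=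
    (integrable_mvPolynomial_eval hX ![c, e] (MvPolynomial.X 1 * MvPolynomial.X 1)).congr
      (ae_of_all _ fun ω => by simp)
  have i12 : Integrable (fun ω => X c ω * X c ω * X e ω * X e ω - (∫ ω', X e ω' * X e ω' ∂P) * (X c ω * X c ω)) P :=
    i4.sub (icc.const_mul _)
  have i34 : Integrable (fun ω => (∫ ω', X c ω' * X c ω' ∂P) * (X e ω * X e ω) -
      (∫ ω', X c ω' * X c ω' ∂P) * (∫ ω', X e ω' * X e ω' ∂P)) P :=
    (iee.const_mul _).sub (integrable_const _)
  have e1 : (fun ω => (X c ω * X c ω - ∫ ω', X c ω' * X c ω' ∂P) * (X e ω * X e ω - ∫ ω', X e ω' * X e ω' ∂P)) =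
      fun ω => (X c ω * X c ω * X e ω * X e ω - (∫ ω', X e ω' * X e ω' ∂P) * (X c ω * X c ω)) -
        ((∫ ω', X c ω' * X c ω' ∂P) * (X e ω * X e ω) -
          (∫ ω', X c ω' * X c ω' ∂P) * (∫ ω', X e ω' * X e ω' ∂P)) := by
    funext ω; ring
  rw [e1, integral_sub i12 i34, integral_sub i4 (icc.const_mul _), integral_sub (iee.const_mul _) (integrable_const _),
    integral_const_mul, integral_const_mul, integral_const, probReal_univ, one_smul,
    integral_sq_mul_sq_gaussianProcess hX h0]
  ring

/-- **A Wick pair against two equal legs**: `E[(X_aX_b − S_ab) X_c²] = 2 S_ac S_bc` (both legs of the pair contracted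
outward). [cite: GlimmJaffeQP1987, Cor. 8.3.2 (8.3.8)–(8.3.9)] -/
theorem integral_wick2_mul_legs2 (hX : IsGaussianProcess X P) (h0 : ∀ t, ∫ ω, X t ω ∂P = 0) (a b c : T) :
    ∫ ω, (X a ω * X b ω - ∫ ω', X a ω' * X b ω' ∂P) * (X c ω * X c ω) ∂P =
      2 * ((∫ ω, X a ω * X c ω ∂P) * (∫ ω, X b ω * X c ω ∂P)) := by
  have := hX.isProbabilityMeasure
  have h := GaussianWick.integral_wick2_mul_prod hX h0 a b (Finset.univ : Finset (Fin 2)) ![c, c]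
  have hu : (Finset.univ : Finset (Fin 2)) = {0, 1} := by decide
  simp only [hu] at h
  simp [Finset.sum_insert, Finset.erase_insert_of_ne] at h
  rw [h]
  ring

/-- **A Wick pair against four legs `c, c, e, e`**: `E[(X_aX_b − S_ab) X_c²X_e²]
= 2S_acS_bcS_ee + 2S_aeS_beS_cc + 4S_ce(S_acS_be + S_aeS_bc)` (the twelve contractions of the pair into the four legs,
the two remaining legs joined). [cite: GlimmJaffeQP1987, Cor. 8.3.2 (8.3.8)–(8.3.9)] -/
theorem integral_wick2_mul_legs4 (hX : IsGaussianProcess X P) (h0 : ∀ t, ∫ ω, X t ω ∂P = 0) (a b c e : T) :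
    ∫ ω, (X a ω * X b ω - ∫ ω', X a ω' * X b ω' ∂P) * (X c ω * X c ω * X e ω * X e ω) ∂P =
      2 * ((∫ ω, X a ω * X c ω ∂P) * (∫ ω, X b ω * X c ω ∂P)) * (∫ ω, X e ω * X e ω ∂P) +
      2 * ((∫ ω, X a ω * X e ω ∂P) * (∫ ω, X b ω * X e ω ∂P)) * (∫ ω, X c ω * X c ω ∂P) +
      4 * (∫ ω, X c ω * X e ω ∂P) *
        ((∫ ω, X a ω * X c ω ∂P) * (∫ ω, X b ω * X e ω ∂P) + (∫ ω, X a ω * X e ω ∂P) * (∫ ω, X b ω * X c ω ∂P)) := by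
  have := hX.isProbabilityMeasure
  have h := GaussianWick.integral_wick2_mul_prod hX h0 a b (Finset.univ : Finset (Fin 4)) ![c, c, e, e]
  simp only [Fin.prod_univ_four, Matrix.cons_val_zero, Matrix.cons_val_one, Matrix.cons_val] at h
  have hu : (Finset.univ : Finset (Fin 4)) = {0, 1, 2, 3} := by decide
  simp only [hu] at h
  simp [Finset.sum_insert, Finset.erase_insert_of_ne, Finset.prod_insert] at h
  rw [h]
  ring

/-- **The Wick-ordered quartet `:X_a²X_b²:` against two equal legs vanishes**: four legs cannot be contracted into
two, `E[:X_a²X_b²: X_c²] = 0`, where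
`:X_a²X_b²: = X_a²X_b² − S_aaX_b² − 4S_abX_aX_b − S_bbX_a² + S_aaS_bb + 2S_ab²`. [cite: GlimmJaffeQP1987, Cor. 8.3.2] -/
theorem integral_wick4sq_mul_legs2 (hX : IsGaussianProcess X P) (h0 : ∀ t, ∫ ω, X t ω ∂P = 0) (a b c : T) :
    ∫ ω, (X a ω * X a ω * (X b ω * X b ω) - (∫ ω', X a ω' * X a ω' ∂P) * (X b ω * X b ω)
        - 4 * (∫ ω', X a ω' * X b ω' ∂P) * (X a ω * X b ω) - (∫ ω', X b ω' * X b ω' ∂P) * (X a ω * X a ω)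
        + ((∫ ω', X a ω' * X a ω' ∂P) * (∫ ω', X b ω' * X b ω' ∂P) + 2 * (∫ ω', X a ω' * X b ω' ∂P) ^ 2)) *
      (X c ω * X c ω) ∂P = 0 := by
  have := hX.isProbabilityMeasure
  have h := GaussianWick.integral_wick4_mul_prod hX h0 a a b b (Finset.univ : Finset (Fin 2)) ![c, c]
  simp only [Fin.prod_univ_two, Matrix.cons_val_zero, Matrix.cons_val_one] at h
  have hu : (Finset.univ : Finset (Fin 2)) = {0, 1} := by decide
  simp only [hu] at h
  simp [Finset.sum_insert, Finset.erase_insert_of_ne] at h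
  rw [← h]
  congr 1
  funext ω
  ring

/-- **The Wick-ordered quartet `:X_a²X_b²:` against four legs `c, c, e, e`**: the `24` complete contractions,
`E[:X_a²X_b²: X_c²X_e²] = 4S_ac²S_be² + 4S_ae²S_bc² + 16 S_acS_aeS_bcS_be`. [cite: GlimmJaffeQP1987, Cor. 8.3.2] -/
theorem integral_wick4sq_mul_legs4 (hX : IsGaussianProcess X P) (h0 : ∀ t, ∫ ω, X t ω ∂P = 0) (a b c e : T) :
    ∫ ω, (X a ω * X a ω * (X b ω * X b ω) - (∫ ω', X a ω' * X a ω' ∂P) * (X b ω * X b ω)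
        - 4 * (∫ ω', X a ω' * X b ω' ∂P) * (X a ω * X b ω) - (∫ ω', X b ω' * X b ω' ∂P) * (X a ω * X a ω)
        + ((∫ ω', X a ω' * X a ω' ∂P) * (∫ ω', X b ω' * X b ω' ∂P) + 2 * (∫ ω', X a ω' * X b ω' ∂P) ^ 2)) *
      (X c ω * X c ω * X e ω * X e ω) ∂P =
      4 * ((∫ ω, X a ω * X c ω ∂P) ^ 2 * (∫ ω, X b ω * X e ω ∂P) ^ 2) +
      4 * ((∫ ω, X a ω * X e ω ∂P) ^ 2 * (∫ ω, X b ω * X c ω ∂P) ^ 2) +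
      16 * ((∫ ω, X a ω * X c ω ∂P) * (∫ ω, X a ω * X e ω ∂P) * (∫ ω, X b ω * X c ω ∂P) *
        (∫ ω, X b ω * X e ω ∂P)) := by
  have := hX.isProbabilityMeasure
  have h := GaussianWick.integral_wick4_mul_prod hX h0 a a b b (Finset.univ : Finset (Fin 4)) ![c, c, e, e]
  simp only [Fin.prod_univ_four, Matrix.cons_val_zero, Matrix.cons_val_one, Matrix.cons_val] at h
  have hu : (Finset.univ : Finset (Fin 4)) = {0, 1, 2, 3} := by decide
  simp only [hu] at h
  simp [Finset.sum_insert, Finset.erase_insert_of_ne] at h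
  have e1 : ∀ ω, (X a ω * X a ω * (X b ω * X b ω) - (∫ ω', X a ω' * X a ω' ∂P) * (X b ω * X b ω)
        - 4 * (∫ ω', X a ω' * X b ω' ∂P) * (X a ω * X b ω) - (∫ ω', X b ω' * X b ω' ∂P) * (X a ω * X a ω)
        + ((∫ ω', X a ω' * X a ω' ∂P) * (∫ ω', X b ω' * X b ω' ∂P) + 2 * (∫ ω', X a ω' * X b ω' ∂P) ^ 2)) *
      (X c ω * X c ω * X e ω * X e ω) =
      (X a ω * X a ω * X b ω * X b ω -
        ((∫ ω', X a ω' * X a ω' ∂P) * (X b ω * X b ω) + (∫ ω', X a ω' * X b ω' ∂P) * (X a ω * X b ω)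
          + (∫ ω', X a ω' * X b ω' ∂P) * (X a ω * X b ω) + (∫ ω', X a ω' * X b ω' ∂P) * (X a ω * X b ω)
          + (∫ ω', X a ω' * X b ω' ∂P) * (X a ω * X b ω) + (∫ ω', X b ω' * X b ω' ∂P) * (X a ω * X a ω))
        + ((∫ ω', X a ω' * X a ω' ∂P) * (∫ ω', X b ω' * X b ω' ∂P)
          + (∫ ω', X a ω' * X b ω' ∂P) * (∫ ω', X a ω' * X b ω' ∂P)
          + (∫ ω', X a ω' * X b ω' ∂P) * (∫ ω', X a ω' * X b ω' ∂P))) *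
      (X c ω * X c ω * X e ω * X e ω) := fun ω => by ring
  simp_rw [e1]
  rw [h]
  ring

/-- `E[:X_a²X_b²:] = 0` (the quartet form of `integral_wick4sq_mul_legs4`). [cite: GlimmJaffeQP1987, Cor. 8.3.2] -/
theorem integral_wick4sq_eq_zero (hX : IsGaussianProcess X P) (h0 : ∀ t, ∫ ω, X t ω ∂P = 0) (a b : T) :
    ∫ ω, (X a ω * X a ω * (X b ω * X b ω) - (∫ ω', X a ω' * X a ω' ∂P) * (X b ω * X b ω)
        - 4 * (∫ ω', X a ω' * X b ω' ∂P) * (X a ω * X b ω) - (∫ ω', X b ω' * X b ω' ∂P) * (X a ω * X a ω)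
        + ((∫ ω', X a ω' * X a ω' ∂P) * (∫ ω', X b ω' * X b ω' ∂P) + 2 * (∫ ω', X a ω' * X b ω' ∂P) ^ 2)) ∂P = 0 := by
  have h := GaussianWick.integral_wick4_eq_zero hX h0 a a b b
  rw [← h]
  congr 1
  funext ω
  ring

/-- **FOUR WICK SQUARES** (the `60` pairings of eight legs with no self-line, grouped): for a centred Gaussian process
and `W_t = X_t² − S_tt`,
`E[W_aW_bW_cW_e] = 4S_ab²S_ce² + 4S_ac²S_be² + 4S_ae²S_bc² + 16S_acS_aeS_bcS_be + 16S_abS_ce(S_acS_be + S_aeS_bc)`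
(three double-edge covers `4·S²S²` and three four-cycles `16·SSSS` of the vertices `a, b, c, e`).  Proof:
`W_aW_b = :X_a²X_b²: + 4S_ab(X_aX_b − S_ab) + 2S_ab²` and the contraction rules `integral_wick4sq_mul_legs4/2`,
`integral_wick2_mul_legs4/2` against the legs of `W_cW_e`. [cite: Janson1997, Thm 1.28] -/
theorem integral_wickSq_four (hX : IsGaussianProcess X P) (h0 : ∀ t, ∫ ω, X t ω ∂P = 0) (a b c e : T) :
    ∫ ω, (X a ω * X a ω - ∫ ω', X a ω' * X a ω' ∂P) * (X b ω * X b ω - ∫ ω', X b ω' * X b ω' ∂P) *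
        ((X c ω * X c ω - ∫ ω', X c ω' * X c ω' ∂P) * (X e ω * X e ω - ∫ ω', X e ω' * X e ω' ∂P)) ∂P =
      4 * ((∫ ω, X a ω * X b ω ∂P) ^ 2 * (∫ ω, X c ω * X e ω ∂P) ^ 2) +
      4 * ((∫ ω, X a ω * X c ω ∂P) ^ 2 * (∫ ω, X b ω * X e ω ∂P) ^ 2) +
      4 * ((∫ ω, X a ω * X e ω ∂P) ^ 2 * (∫ ω, X b ω * X c ω ∂P) ^ 2) +
      16 * ((∫ ω, X a ω * X c ω ∂P) * (∫ ω, X a ω * X e ω ∂P) * (∫ ω, X b ω * X c ω ∂P) *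
        (∫ ω, X b ω * X e ω ∂P)) +
      16 * ((∫ ω, X a ω * X b ω ∂P) * (∫ ω, X c ω * X e ω ∂P)) *
        ((∫ ω, X a ω * X c ω ∂P) * (∫ ω, X b ω * X e ω ∂P) + (∫ ω, X a ω * X e ω ∂P) * (∫ ω, X b ω * X c ω ∂P)) := by
  have := hX.isProbabilityMeasure
  -- abbreviations (values of the two-point function)
  set Saa : ℝ := ∫ ω', X a ω' * X a ω' ∂P with hSaa
  set Sbb : ℝ := ∫ ω', X b ω' * X b ω' ∂P with hSbb
  set Scc : ℝ := ∫ ω', X c ω' * X c ω' ∂P with hScc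
  set See : ℝ := ∫ ω', X e ω' * X e ω' ∂P with hSee
  set Sab : ℝ := ∫ ω', X a ω' * X b ω' ∂P with hSab
  set Sac : ℝ := ∫ ω', X a ω' * X c ω' ∂P with hSac
  set Sae : ℝ := ∫ ω', X a ω' * X e ω' ∂P with hSae
  set Sbc : ℝ := ∫ ω', X b ω' * X c ω' ∂P with hSbc
  set Sbe : ℝ := ∫ ω', X b ω' * X e ω' ∂P with hSbe
  set Sce : ℝ := ∫ ω', X c ω' * X e ω' ∂P with hSce
  -- the quartet, the pair and the legs
  set Q : Ω → ℝ := fun ω => X a ω * X a ω * (X b ω * X b ω) - Saa * (X b ω * X b ω)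
        - 4 * Sab * (X a ω * X b ω) - Sbb * (X a ω * X a ω) + (Saa * Sbb + 2 * Sab ^ 2) with hQ
  set Pab : Ω → ℝ := fun ω => X a ω * X b ω - Sab with hPab
  set F : Ω → ℝ := fun ω => (X c ω * X c ω - Scc) * (X e ω * X e ω - See) with hF
  -- the evaluation vector for the polynomial integrability lemma
  have hI : ∀ q : MvPolynomial (Fin 4) ℝ, Integrable (fun ω => MvPolynomial.eval (fun i => X (![a, b, c, e] i) ω) q) P :=
    fun q => integrable_mvPolynomial_eval hX ![a, b, c, e] q
  -- Step 1: the quartet against `F`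
  have hQL4 : ∫ ω, Q ω * (X c ω * X c ω * X e ω * X e ω) ∂P =
      4 * (Sac ^ 2 * Sbe ^ 2) + 4 * (Sae ^ 2 * Sbc ^ 2) + 16 * (Sac * Sae * Sbc * Sbe) :=
    integral_wick4sq_mul_legs4 hX h0 a b c e
  have hQLcc : ∫ ω, Q ω * (X c ω * X c ω) ∂P = 0 := integral_wick4sq_mul_legs2 hX h0 a b c
  have hQLee : ∫ ω, Q ω * (X e ω * X e ω) ∂P = 0 := integral_wick4sq_mul_legs2 hX h0 a b e
  have hQ0 : ∫ ω, Q ω ∂P = 0 := integral_wick4sq_eq_zero hX h0 a b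
  have iQL4 : Integrable (fun ω => Q ω * (X c ω * X c ω * X e ω * X e ω)) P :=
    (hI ((MvPolynomial.X 0 * MvPolynomial.X 0 * (MvPolynomial.X 1 * MvPolynomial.X 1)
        - MvPolynomial.C Saa * (MvPolynomial.X 1 * MvPolynomial.X 1)
        - 4 * MvPolynomial.C Sab * (MvPolynomial.X 0 * MvPolynomial.X 1)
        - MvPolynomial.C Sbb * (MvPolynomial.X 0 * MvPolynomial.X 0) + MvPolynomial.C (Saa * Sbb + 2 * Sab ^ 2)) *
        (MvPolynomial.X 2 * MvPolynomial.X 2 * MvPolynomial.X 3 * MvPolynomial.X 3))).congr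
      (ae_of_all _ fun ω => by simp [hQ])
  have iQLcc : Integrable (fun ω => Q ω * (X c ω * X c ω)) P :=
    (hI ((MvPolynomial.X 0 * MvPolynomial.X 0 * (MvPolynomial.X 1 * MvPolynomial.X 1)
        - MvPolynomial.C Saa * (MvPolynomial.X 1 * MvPolynomial.X 1)
        - 4 * MvPolynomial.C Sab * (MvPolynomial.X 0 * MvPolynomial.X 1)
        - MvPolynomial.C Sbb * (MvPolynomial.X 0 * MvPolynomial.X 0) + MvPolynomial.C (Saa * Sbb + 2 * Sab ^ 2)) *
        (MvPolynomial.X 2 * MvPolynomial.X 2))).congr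
      (ae_of_all _ fun ω => by simp [hQ])
  have iQLee : Integrable (fun ω => Q ω * (X e ω * X e ω)) P :=
    (hI ((MvPolynomial.X 0 * MvPolynomial.X 0 * (MvPolynomial.X 1 * MvPolynomial.X 1)
        - MvPolynomial.C Saa * (MvPolynomial.X 1 * MvPolynomial.X 1)
        - 4 * MvPolynomial.C Sab * (MvPolynomial.X 0 * MvPolynomial.X 1)
        - MvPolynomial.C Sbb * (MvPolynomial.X 0 * MvPolynomial.X 0) + MvPolynomial.C (Saa * Sbb + 2 * Sab ^ 2)) *
        (MvPolynomial.X 3 * MvPolynomial.X 3))).congr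
      (ae_of_all _ fun ω => by simp [hQ])
  have iQ : Integrable Q P :=
    (hI (MvPolynomial.X 0 * MvPolynomial.X 0 * (MvPolynomial.X 1 * MvPolynomial.X 1)
        - MvPolynomial.C Saa * (MvPolynomial.X 1 * MvPolynomial.X 1)
        - 4 * MvPolynomial.C Sab * (MvPolynomial.X 0 * MvPolynomial.X 1)
        - MvPolynomial.C Sbb * (MvPolynomial.X 0 * MvPolynomial.X 0) + MvPolynomial.C (Saa * Sbb + 2 * Sab ^ 2))).congr
      (ae_of_all _ fun ω => by simp [hQ])
  have hQF : ∫ ω, Q ω * F ω ∂P = 4 * (Sac ^ 2 * Sbe ^ 2) + 4 * (Sae ^ 2 * Sbc ^ 2) + 16 * (Sac * Sae * Sbc * Sbe) := by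
    have e1 : (fun ω => Q ω * F ω) = fun ω =>
        (Q ω * (X c ω * X c ω * X e ω * X e ω) - See * (Q ω * (X c ω * X c ω))) -
          (Scc * (Q ω * (X e ω * X e ω)) - Scc * See * Q ω) := by
      funext ω; simp only [hF]; ring
    have i12 : Integrable (fun ω => Q ω * (X c ω * X c ω * X e ω * X e ω) - See * (Q ω * (X c ω * X c ω))) P :=
      iQL4.sub (iQLcc.const_mul _)
    have i34 : Integrable (fun ω => Scc * (Q ω * (X e ω * X e ω)) - Scc * See * Q ω) P :=
      (iQLee.const_mul _).sub (iQ.const_mul _)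
    rw [e1, integral_sub i12 i34, integral_sub iQL4 (iQLcc.const_mul _),
      integral_sub (iQLee.const_mul _) (iQ.const_mul _), integral_const_mul, integral_const_mul, integral_const_mul,
      hQL4, hQLcc, hQLee, hQ0]
    ring
  -- Step 2: the pair against `F`
  have hPL4 : ∫ ω, Pab ω * (X c ω * X c ω * X e ω * X e ω) ∂P =
      2 * (Sac * Sbc) * See + 2 * (Sae * Sbe) * Scc + 4 * Sce * (Sac * Sbe + Sae * Sbc) :=
    integral_wick2_mul_legs4 hX h0 a b c e
  have hPLcc : ∫ ω, Pab ω * (X c ω * X c ω) ∂P = 2 * (Sac * Sbc) := integral_wick2_mul_legs2 hX h0 a b c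
  have hPLee : ∫ ω, Pab ω * (X e ω * X e ω) ∂P = 2 * (Sae * Sbe) := integral_wick2_mul_legs2 hX h0 a b e
  have hP0 : ∫ ω, Pab ω ∂P = 0 := GaussianWick.integral_wick2_eq_zero hX h0 a b
  have iPL4 : Integrable (fun ω => Pab ω * (X c ω * X c ω * X e ω * X e ω)) P :=
    (hI ((MvPolynomial.X 0 * MvPolynomial.X 1 - MvPolynomial.C Sab) *
        (MvPolynomial.X 2 * MvPolynomial.X 2 * MvPolynomial.X 3 * MvPolynomial.X 3))).congr
      (ae_of_all _ fun ω => by simp [hPab])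
  have iPLcc : Integrable (fun ω => Pab ω * (X c ω * X c ω)) P :=
    (hI ((MvPolynomial.X 0 * MvPolynomial.X 1 - MvPolynomial.C Sab) * (MvPolynomial.X 2 * MvPolynomial.X 2))).congr
      (ae_of_all _ fun ω => by simp [hPab])
  have iPLee : Integrable (fun ω => Pab ω * (X e ω * X e ω)) P :=
    (hI ((MvPolynomial.X 0 * MvPolynomial.X 1 - MvPolynomial.C Sab) * (MvPolynomial.X 3 * MvPolynomial.X 3))).congr
      (ae_of_all _ fun ω => by simp [hPab])
  have iP : Integrable Pab P :=
    (hI (MvPolynomial.X 0 * MvPolynomial.X 1 - MvPolynomial.C Sab)).congr (ae_of_all _ fun ω => by simp [hPab])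
  have hPF : ∫ ω, Pab ω * F ω ∂P = 4 * Sce * (Sac * Sbe + Sae * Sbc) := by
    have e1 : (fun ω => Pab ω * F ω) = fun ω =>
        (Pab ω * (X c ω * X c ω * X e ω * X e ω) - See * (Pab ω * (X c ω * X c ω))) -
          (Scc * (Pab ω * (X e ω * X e ω)) - Scc * See * Pab ω) := by
      funext ω; simp only [hF]; ring
    have i12 : Integrable (fun ω => Pab ω * (X c ω * X c ω * X e ω * X e ω) - See * (Pab ω * (X c ω * X c ω))) P :=
      iPL4.sub (iPLcc.const_mul _)
    have i34 : Integrable (fun ω => Scc * (Pab ω * (X e ω * X e ω)) - Scc * See * Pab ω) P :=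
      (iPLee.const_mul _).sub (iP.const_mul _)
    rw [e1, integral_sub i12 i34, integral_sub iPL4 (iPLcc.const_mul _),
      integral_sub (iPLee.const_mul _) (iP.const_mul _), integral_const_mul, integral_const_mul, integral_const_mul,
      hPL4, hPLcc, hPLee, hP0]
    ring
  -- Step 3: `E[F] = 2 S_ce²`
  have hF2 : ∫ ω, F ω ∂P = 2 * Sce ^ 2 := integral_wickSq_mul_wickSq hX h0 c e
  have iF : Integrable F P :=
    (hI ((MvPolynomial.X 2 * MvPolynomial.X 2 - MvPolynomial.C Scc) *
        (MvPolynomial.X 3 * MvPolynomial.X 3 - MvPolynomial.C See))).congr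
      (ae_of_all _ fun ω => by simp [hF])
  have iQF : Integrable (fun ω => Q ω * F ω) P :=
    (hI ((MvPolynomial.X 0 * MvPolynomial.X 0 * (MvPolynomial.X 1 * MvPolynomial.X 1)
        - MvPolynomial.C Saa * (MvPolynomial.X 1 * MvPolynomial.X 1)
        - 4 * MvPolynomial.C Sab * (MvPolynomial.X 0 * MvPolynomial.X 1)
        - MvPolynomial.C Sbb * (MvPolynomial.X 0 * MvPolynomial.X 0) + MvPolynomial.C (Saa * Sbb + 2 * Sab ^ 2)) *
        ((MvPolynomial.X 2 * MvPolynomial.X 2 - MvPolynomial.C Scc) *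
          (MvPolynomial.X 3 * MvPolynomial.X 3 - MvPolynomial.C See)))).congr
      (ae_of_all _ fun ω => by simp [hQ, hF])
  have iPF : Integrable (fun ω => Pab ω * F ω) P :=
    (hI ((MvPolynomial.X 0 * MvPolynomial.X 1 - MvPolynomial.C Sab) *
        ((MvPolynomial.X 2 * MvPolynomial.X 2 - MvPolynomial.C Scc) *
          (MvPolynomial.X 3 * MvPolynomial.X 3 - MvPolynomial.C See)))).congr
      (ae_of_all _ fun ω => by simp [hPab, hF])
  -- Step 4: assemble `W_aW_b = Q + 4 S_ab P + 2 S_ab²`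
  have e0 : (fun ω => (X a ω * X a ω - Saa) * (X b ω * X b ω - Sbb) * ((X c ω * X c ω - Scc) * (X e ω * X e ω - See))) =
      fun ω => Q ω * F ω + 4 * Sab * (Pab ω * F ω) + 2 * Sab ^ 2 * F ω := by
    funext ω; simp only [hQ, hPab, hF]; ring
  have i1 : Integrable (fun ω => Q ω * F ω + 4 * Sab * (Pab ω * F ω)) P := iQF.add (iPF.const_mul _)
  rw [e0, integral_add i1 (iF.const_mul _), integral_add iQF (iPF.const_mul _),
    integral_const_mul, integral_const_mul, hQF, hPF, hF2]
  ring

end WickSquares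

end Summit.QuantumFields.YangMills.Cruxes.SourcedPressureIncrement.Birth
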